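import Summits.BirchSwinnertonDyer.BirchSwinnertonDyer.Theorems.ClassRecordThreeRegCertKernelO2Log
import Summits.BirchSwinnertonDyer.BirchSwinnertonDyer.Theorems.ClassRecordThreeRegCertKernelHeight
import HarnessLib

/-!
# Route `ClassRecordThree`, crux `SchneiderAtThree` (item 19106): the SECOND-ORDER kernel evaluator for the
# Stein–Wuthrich §4.2 height at `v₃(e(Q)) = 1` — `h mod 27` from a residue certificate `(γ, ζ, ℓ, ω, κ, u)`
# (cell `bsd-stepL`, seat `bsd-stepL-reg3-eng` g3; `--supports stmt-BirchSwinnertonDyer-19106`)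

HONEST FRAMING: BSD is not proved by any of this; nothing here closes the crux; Schneider's conjecture (barrier
`PAdicHeightNondegeneracy`) is asserted NOWHERE. Second-order twin of `…RegCertKernelHeight` for REG3CERT rows with
`v₃(e(Q)) = 1`, `v₃(h(Q)) = 2` (110 of the 723 TRUE-OPEN non-split (ram) X11b@3 rows): `γ ≡ C² (mod 27)`
(`27 ∣ c₄c₄³ + γc₆(c₄³ + 240Δ)`, THE Tate parameter entering through `q ≡ Δ/c₄³`), `ζ, ℓ (mod 3⁴)` as at first order,
`ω ≡ w (mod 3⁵)` (`3⁵ ∣ ℓ² − ωγ`), `κ ≡ ch(w) − 1 (mod 3⁵)` (`3⁷ ∣ 360ω + 30ω² + ω³ − 720κ`; §1 the `cosh` series to its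
cubic term), `C²σ² ≡ 9u (mod 3⁵)`, and the Iwasawa logarithms to three terms (§2), give
`h ≡ ½[(E − E²/2 + E³/3) − (U − U²/2 + U³/3)] (mod 27)` with `E = e'⁴ − 1`, `U = u² − 1`; CERTIFICATE
**`3⁴ ∤ 6E − 3E² + 2E³ − 6U + 3U² − 2U³`** ⇒ `h ≠ 0` (§3 `heightFourOneCoord_ne_zero_of_residueCertO2`). Validated offline
on all 444 rows with `v₃(e(Q)) = 1` of kit j249075. Theorems only (0 defs, 0 facts). References: [SteinWuthrich2013]
§4.2; [Iwasawa1972PadicL] §4.4; [SilvermanATAEC1994] V.3, V.5.1.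
-/

open scoped Classical
open WeierstrassCurve Literature.NumberTheory.EllipticCurves
  Literature.NumberTheory.EllipticCurves.SteinWuthrich2013
  Summit.BirchSwinnertonDyer.Rank1Residual.X11b.RegMult.Rung62310y1

namespace Summit.BirchSwinnertonDyer.Rank1Residual.X11b.RegMult.KernelCert

/-! ### §0 Plumbing -/
/-- Ultrametric inequality for differences. [folklore] -/
private theorem norm_sub_le_max₃ (a b : ℚ_[3]) : ‖a - b‖ ≤ max ‖a‖ ‖b‖ := by
  rw [sub_eq_add_neg, ← norm_neg b]; exact IsUltrametricDist.norm_add_le_max a (-b)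

/-- `‖(2 : ℚ₃)⁻¹‖ = 1`. [folklore] -/
private theorem norm_inv_two₃ : ‖(2 : ℚ_[3])⁻¹‖ = 1 := by
  rw [norm_inv, show (2 : ℚ_[3]) = ((2 : ℤ) : ℚ_[3]) by norm_cast, norm_intCast_eq_one_of_not_dvd (by decide),
    inv_one]

/-- `‖(m : ℚ₃)⁻¹‖ = 3ᵏ` for `m = u·3ᵏ`, `3 ∤ u` (used at `m = 12, 24, 720, 8!, 10!`). [folklore] -/
private theorem norm_inv_natCast_eq {m u k : ℕ} (hm : m = u * 3 ^ k) (hu : ¬ 3 ∣ u) :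
    ‖((m : ℚ_[3]))⁻¹‖ = (3 : ℝ) ^ k := by
  have hun : ‖((u : ℤ) : ℚ_[3])‖ = 1 := norm_intCast_eq_one_of_not_dvd (by exact_mod_cast hu)
  rw [hm]; push_cast
  rw [mul_inv, norm_mul, norm_inv, show ((u : ℚ_[3])) = ((u : ℤ) : ℚ_[3]) by norm_cast, hun, inv_one, one_mul,
    norm_inv, norm_pow, show (3 : ℚ_[3]) = ((3 : ℕ) : ℚ_[3]) by norm_cast, Padic.norm_p]
  simp

/-- **Legendre at `p = 3`**: `‖1/(2n)!‖₃ ≤ 3ⁿ`. [Silverman AEC IV.6.3(a)] [folklore] -/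
private theorem norm_inv_factorial_le₃ (n : ℕ) : ‖(((2 * n).factorial : ℕ) : ℚ_[3])⁻¹‖ ≤ (3 : ℝ) ^ n := by
  have hf : ((2 * n).factorial : ℕ) ≠ 0 := Nat.factorial_ne_zero _
  rw [norm_inv, Padic.norm_eq_zpow_neg_valuation (by exact_mod_cast hf), Padic.valuation_natCast, zpow_neg,
    inv_inv, zpow_natCast]
  have hv : padicValNat 3 (2 * n).factorial ≤ n := by
    have h := sub_one_mul_padicValNat_factorial (p := 3) (2 * n)
    have hs : (3 - 1) * padicValNat 3 (2 * n).factorial ≤ 2 * n := by rw [h]; exact Nat.sub_le _ _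
    omega
  exact_mod_cast Nat.pow_le_pow_right (by norm_num) hv

/-- `3 ∤ u ⇒ 3 ∣ u² − 1`. [folklore] -/
private theorem three_dvd_sq_sub_one' {u : ℤ} (h : ¬ (3 : ℤ) ∣ u) : (3 : ℤ) ∣ u ^ 2 - 1 := by
  have key : ∀ x : ZMod 3, x ≠ 0 → x ^ 2 - 1 = 0 := by decide
  have hx : ((u : ZMod 3)) ≠ 0 := by rw [Ne, ZMod.intCast_zmod_eq_zero_iff_dvd]; exact_mod_cast h
  have h2 : (((u ^ 2 - 1 : ℤ)) : ZMod 3) = 0 := by push_cast; exact key _ hx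
  exact_mod_cast (ZMod.intCast_zmod_eq_zero_iff_dvd _ 3).mp h2

/-! ### §1 The `cosh` series to its cubic term -/

/-- **`‖ch(w) − (1 + w/2 + w²/24 + w³/720)‖₃ ≤ 9‖w‖⁴` for `‖w‖₃ ≤ 3⁻²`**: the quartic term has norm
`‖w‖⁴·‖1/8!‖ = 9‖w‖⁴`, the quintic `‖w‖⁵·‖1/10!‖ = 81‖w‖⁵ ≤ 9‖w‖⁴`, and every later term `≤ 3ⁿ‖w‖ⁿ ≤ 9‖w‖⁴` (Legendre).
[folklore] -/
theorem norm_coshOfSq_sub_cubic_le {w : ℚ_[3]} (hw : ‖w‖ ≤ 1 / 9) :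
    ‖coshOfSq w - (1 + w / 2 + w ^ 2 / 24 + w ^ 3 / 720)‖ ≤ 9 * ‖w‖ ^ 4 := by
  have hsplit := (summable_coshOfSq_term hw).sum_add_tsum_nat_add 4
  have hdef : coshOfSq w = ∑' n : ℕ, w ^ n / (((2 * n).factorial : ℕ) : ℚ_[3]) := by rw [coshOfSq]
  rw [hdef, ← hsplit]
  simp only [Finset.sum_range_succ, Finset.sum_range_zero, zero_add, pow_zero, Nat.mul_zero, Nat.factorial_zero,
    Nat.cast_one, div_one, pow_one]
  have h2 : (((2 * 1).factorial : ℕ) : ℚ_[3]) = 2 := by norm_num [Nat.factorial]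
  have h24 : (((2 * 2).factorial : ℕ) : ℚ_[3]) = 24 := by norm_num [Nat.factorial]
  have h720 : (((2 * 3).factorial : ℕ) : ℚ_[3]) = 720 := by norm_num [Nat.factorial]
  rw [h2, h24, h720]
  have hring : 1 + w / 2 + w ^ 2 / 24 + w ^ 3 / 720 +
      ∑' n : ℕ, w ^ (n + 4) / (((2 * (n + 4)).factorial : ℕ) : ℚ_[3]) - (1 + w / 2 + w ^ 2 / 24 + w ^ 3 / 720) =
      ∑' n : ℕ, w ^ (n + 4) / (((2 * (n + 4)).factorial : ℕ) : ℚ_[3]) := by ring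
  rw [hring]
  refine IsUltrametricDist.norm_tsum_le_of_forall_le_of_nonneg (by positivity) fun n ↦ ?_
  rw [div_eq_mul_inv, norm_mul, norm_pow]
  rcases Nat.lt_or_ge n 2 with hn | hn
  · interval_cases n
    · -- `w⁴/8!`, `8! = 4480·9`
      have hf : (2 * (0 + 4)).factorial = 4480 * 3 ^ 2 := by decide
      rw [norm_inv_natCast_eq hf (by norm_num),
        show ‖w‖ ^ (0 + 4) * (3 : ℝ) ^ 2 = 9 * ‖w‖ ^ 4 by ring]
    · -- `w⁵/10!`, `10! = 44800·81`
      have hf : (2 * (1 + 4)).factorial = 44800 * 3 ^ 4 := by decide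
      rw [norm_inv_natCast_eq hf (by norm_num)]
      calc ‖w‖ ^ (1 + 4) * (3 : ℝ) ^ 4 = 9 * ‖w‖ ^ 4 * (9 * ‖w‖) := by ring
        _ ≤ 9 * ‖w‖ ^ 4 * (9 * (1 / 9)) := by gcongr
        _ = 9 * ‖w‖ ^ 4 := by norm_num
  · obtain ⟨k, rfl⟩ : ∃ k, n = k + 2 := ⟨n - 2, by omega⟩
    have hfac := norm_inv_factorial_le₃ (k + 2 + 4)
    calc ‖w‖ ^ (k + 2 + 4) * ‖((((2 * (k + 2 + 4)).factorial : ℕ) : ℚ_[3]))⁻¹‖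
        ≤ ‖w‖ ^ (k + 2 + 4) * (3 : ℝ) ^ (k + 2 + 4) := by gcongr
      _ = 9 * ‖w‖ ^ 4 * ((3 * ‖w‖) ^ k * (81 * ‖w‖ ^ 2)) := by ring
      _ ≤ 9 * ‖w‖ ^ 4 * ((3 * (1 / 9)) ^ k * (81 * (1 / 9) ^ 2)) := by gcongr
      _ ≤ 9 * ‖w‖ ^ 4 * 1 := by
          gcongr
          calc (3 * (1 / 9) : ℝ) ^ k * (81 * (1 / 9) ^ 2) ≤ 1 ^ k * (81 * (1 / 9) ^ 2) := by gcongr; norm_num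
            _ ≤ 1 := by norm_num
      _ = 9 * ‖w‖ ^ 4 := mul_one _

/-- **`ch(w) − 1 ≡ κ (mod 3⁵)`** from `‖w − ω‖₃ ≤ 3⁻⁵`, `9 ∣ ω`, `3⁷ ∣ 360ω + 30ω² + ω³ − 720κ`. [folklore] -/
theorem norm_coshOfSq_sub_one_sub_intCast_le_o2 {w : ℚ_[3]} {ω κ : ℤ} (hw : ‖w - ω‖ ≤ 1 / 243)
    (hω9 : (9 : ℤ) ∣ ω) (hκ : (2187 : ℤ) ∣ 360 * ω + 30 * ω ^ 2 + ω ^ 3 - 720 * κ) :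
    ‖(coshOfSq w - 1) - κ‖ ≤ 1 / 243 := by
  have hωn : ‖(ω : ℚ_[3])‖ ≤ 1 / 9 := (norm_intCast_le_of_pow_dvd (k := 2) (by norm_num; exact hω9)).trans (by norm_num)
  have hwn : ‖w‖ ≤ 1 / 9 := by
    rw [show w = (w - ω) + ω by ring]; exact (IsUltrametricDist.norm_add_le_max _ _).trans (max_le (hw.trans (by norm_num)) hωn)
  have hcosh := norm_coshOfSq_sub_cubic_le hwn
  have h24 : ‖(24 : ℚ_[3])⁻¹‖ = 3 := by
    rw [show (24 : ℚ_[3]) = ((24 : ℕ) : ℚ_[3]) by norm_cast]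
    have := norm_inv_natCast_eq (m := 24) (u := 8) (k := 1) (by norm_num) (by norm_num)
    rw [this, pow_one]
  have h720 : ‖(720 : ℚ_[3])⁻¹‖ = 9 := by
    rw [show (720 : ℚ_[3]) = ((720 : ℕ) : ℚ_[3]) by norm_cast]
    have := norm_inv_natCast_eq (m := 720) (u := 80) (k := 2) (by norm_num) (by norm_num)
    rw [this]; norm_num
  have hsplit : (coshOfSq w - 1) - κ = (coshOfSq w - (1 + w / 2 + w ^ 2 / 24 + w ^ 3 / 720)) +
      (w - ω) * ((2 : ℚ_[3])⁻¹ + (24 : ℚ_[3])⁻¹ * (w + ω) + (720 : ℚ_[3])⁻¹ * (w ^ 2 + w * ω + (ω : ℚ_[3]) ^ 2)) +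
      (720 : ℚ_[3])⁻¹ * (((360 * ω + 30 * ω ^ 2 + ω ^ 3 - 720 * κ : ℤ) : ℚ_[3])) := by
    have h2 : (2 : ℚ_[3]) ≠ 0 := by norm_num
    have h24' : (24 : ℚ_[3]) ≠ 0 := by norm_num
    have h720' : (720 : ℚ_[3]) ≠ 0 := by norm_num
    push_cast; field_simp; ring
  rw [hsplit]
  have hwω : ‖w + ω‖ ≤ 1 / 9 := (IsUltrametricDist.norm_add_le_max _ _).trans (max_le hwn hωn)
  have hq2 : ‖w ^ 2 + w * ω + (ω : ℚ_[3]) ^ 2‖ ≤ 1 / 81 := by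
    refine (IsUltrametricDist.norm_add_le_max _ _).trans (max_le ?_ ?_)
    · refine (IsUltrametricDist.norm_add_le_max _ _).trans (max_le ?_ ?_)
      · rw [norm_pow]; calc ‖w‖ ^ 2 ≤ (1 / 9) ^ 2 := by gcongr
          _ = 1 / 81 := by norm_num
      · rw [norm_mul]; calc ‖w‖ * ‖(ω : ℚ_[3])‖ ≤ 1 / 9 * (1 / 9) := by gcongr
          _ = 1 / 81 := by norm_num
    · rw [norm_pow]; calc ‖(ω : ℚ_[3])‖ ^ 2 ≤ (1 / 9) ^ 2 := by gcongr
        _ = 1 / 81 := by norm_num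
  refine (IsUltrametricDist.norm_add_le_max _ _).trans (max_le ?_ ?_)
  · refine (IsUltrametricDist.norm_add_le_max _ _).trans (max_le (hcosh.trans ?_) ?_)
    · calc 9 * ‖w‖ ^ 4 ≤ 9 * (1 / 9) ^ 4 := by gcongr
        _ ≤ 1 / 243 := by norm_num
    · rw [norm_mul]
      have hbr : ‖(2 : ℚ_[3])⁻¹ + (24 : ℚ_[3])⁻¹ * (w + ω) +
          (720 : ℚ_[3])⁻¹ * (w ^ 2 + w * ω + (ω : ℚ_[3]) ^ 2)‖ ≤ 1 := by
        refine (IsUltrametricDist.norm_add_le_max _ _).trans (max_le ?_ ?_)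
        · refine (IsUltrametricDist.norm_add_le_max _ _).trans (max_le (by rw [norm_inv_two₃]) ?_)
          rw [norm_mul, h24]
          calc 3 * ‖w + ω‖ ≤ 3 * (1 / 9) := by gcongr
            _ ≤ 1 := by norm_num
        · rw [norm_mul, h720]
          calc 9 * ‖w ^ 2 + w * ω + (ω : ℚ_[3]) ^ 2‖ ≤ 9 * (1 / 81) := by gcongr
            _ ≤ 1 := by norm_num
      calc ‖w - ω‖ * _ ≤ 1 / 243 * 1 := by gcongr
        _ = 1 / 243 := mul_one _
  · rw [norm_mul, h720]
    calc 9 * ‖(((360 * ω + 30 * ω ^ 2 + ω ^ 3 - 720 * κ : ℤ) : ℚ_[3]))‖ ≤ 9 * (1 / 2187) := by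
          gcongr; exact (norm_intCast_le_of_pow_dvd (k := 7) (by norm_num; exact hκ)).trans (by norm_num)
      _ = 1 / 243 := by norm_num

/-! ### §2 The Iwasawa logarithm at valuation `2` to second order -/

/-- **`‖Y − 9u‖₃ ≤ 3⁻⁵`, `3 ∤ u ⇒ ‖log₃ Y − ½(U − U²/2 + U³/3)‖₃ ≤ 3⁻³`, `U = u² − 1`** (`log₃ Y = 2⁻¹L(t²)`,
`t = Y·3⁻²`, `‖t − u‖ ≤ 3⁻³`; `L(s) = −T − T²/2 − T³/3 + O(‖T‖⁴)`, `T = 1 − s`, §O2Log; the cubic polynomial is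
`1`-Lipschitz on `‖T‖ ≤ 3⁻¹`). [cite: Iwasawa1972PadicL, §4.4] -/
theorem norm_padicLog_sub_le_of_norm_sub_le_o2 {Y : ℚ_[3]} {u : ℤ} (h3u : ¬ (3 : ℤ) ∣ u) (hY : ‖Y - 9 * u‖ ≤ 1 / 243) :
    ‖padicLog 3 Y - (2 : ℚ_[3])⁻¹ * ((((u ^ 2 - 1 : ℤ)) : ℚ_[3]) - (((u ^ 2 - 1 : ℤ)) : ℚ_[3]) ^ 2 / 2 +
      (((u ^ 2 - 1 : ℤ)) : ℚ_[3]) ^ 3 / 3)‖ ≤ 1 / 27 := by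
  have hun : ‖(u : ℚ_[3])‖ = 1 := norm_intCast_eq_one_of_not_dvd h3u
  have h9 : ‖(9 : ℚ_[3])‖ = 1 / 9 := by
    rw [show (9 : ℚ_[3]) = (3 : ℚ_[3]) ^ (2 : ℤ) by norm_num, show (3 : ℚ_[3]) = ((3 : ℕ) : ℚ_[3]) by norm_cast,
      Padic.norm_p_zpow]; norm_num
  have h9u : ‖(9 : ℚ_[3]) * u‖ = 1 / 9 := by rw [norm_mul, h9, hun, mul_one]
  have hYn : ‖Y‖ = 1 / 9 := by
    rw [← h9u]; exact Padic.norm_eq_of_norm_sub_lt_right (hY.trans_lt (by rw [h9u]; norm_num))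
  have hY0 : Y ≠ 0 := by intro h; rw [h, norm_zero] at hYn; norm_num at hYn
  rw [show padicLog 3 Y = (2 : ℚ_[3])⁻¹ * padicLogSeries 3 ((Y * (3 : ℚ_[3]) ^ (-(2 : ℤ))) ^ 2) by
    rw [padicLog_of_ne_zero hY0, valuation_eq_of_norm_eq hY0 (n := 2) (by rw [hYn]; norm_num)]; norm_num]
  set t : ℚ_[3] := Y * (3 : ℚ_[3]) ^ (-(2 : ℤ)) with ht
  have htu : t - u = (Y - 9 * u) * (3 : ℚ_[3]) ^ (-(2 : ℤ)) := by
    rw [ht, zpow_neg, zpow_two]; field_simp; ring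
  have h3m2 : ‖(3 : ℚ_[3]) ^ (-(2 : ℤ))‖ = 9 := by
    rw [show (3 : ℚ_[3]) = ((3 : ℕ) : ℚ_[3]) by norm_cast, Padic.norm_p_zpow]; norm_num
  have htun : ‖t - u‖ ≤ 1 / 27 := by
    rw [htu, norm_mul, h3m2]
    calc ‖Y - 9 * u‖ * 9 ≤ 1 / 243 * 9 := by gcongr
      _ = 1 / 27 := by norm_num
  have htu1 : ‖t + u‖ ≤ 1 := by
    rw [show t + u = (t - u) + 2 * u by ring]
    refine (IsUltrametricDist.norm_add_le_max _ _).trans (max_le (htun.trans (by norm_num)) ?_)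
    rw [show (2 : ℚ_[3]) * u = ((2 * u : ℤ) : ℚ_[3]) by push_cast; ring]; exact Padic.norm_int_le_one _
  set T : ℚ_[3] := 1 - t ^ 2 with hT
  set T0 : ℚ_[3] := 1 - (u : ℚ_[3]) ^ 2 with hT0
  have hTT0 : ‖T - T0‖ ≤ 1 / 27 := by
    rw [show T - T0 = -((t - u) * (t + u)) by rw [hT, hT0]; ring, norm_neg, norm_mul]
    calc ‖t - u‖ * ‖t + u‖ ≤ 1 / 27 * 1 := by gcongr
      _ = 1 / 27 := mul_one _
  have hT0n : ‖T0‖ ≤ 1 / 3 := by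
    rw [hT0, show (1 : ℚ_[3]) - (u : ℚ_[3]) ^ 2 = -(((u ^ 2 - 1 : ℤ) : ℚ_[3])) by push_cast; ring, norm_neg]
    exact (norm_intCast_le_of_pow_dvd (k := 1) (by simpa using three_dvd_sq_sub_one' h3u)).trans (by norm_num)
  have hTn : ‖T‖ ≤ 1 / 3 := by
    rw [show T = (T - T0) + T0 by ring]; exact (IsUltrametricDist.norm_add_le_max _ _).trans (max_le (hTT0.trans (by norm_num)) hT0n)
  have hL := norm_padicLogSeries_add_cubic_le (y := t ^ 2) (by rw [← hT]; exact hTn)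
  rw [← hT] at hL
  have hP : ‖(T + T ^ 2 / 2 + T ^ 3 / 3) - (T0 + T0 ^ 2 / 2 + T0 ^ 3 / 3)‖ ≤ 1 / 27 := by
    have hid : (T + T ^ 2 / 2 + T ^ 3 / 3) - (T0 + T0 ^ 2 / 2 + T0 ^ 3 / 3) =
        (T - T0) * (1 + (2 : ℚ_[3])⁻¹ * (T + T0) + (3 : ℚ_[3])⁻¹ * (T ^ 2 + T * T0 + T0 ^ 2)) := by
      have h2 : (2 : ℚ_[3]) ≠ 0 := by norm_num
      have h3 : (3 : ℚ_[3]) ≠ 0 := by norm_num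
      field_simp; ring
    rw [hid, norm_mul]
    have h3i : ‖(3 : ℚ_[3])⁻¹‖ = 3 := by
      rw [norm_inv, show (3 : ℚ_[3]) = ((3 : ℕ) : ℚ_[3]) by norm_cast, Padic.norm_p]; norm_num
    have hbr : ‖1 + (2 : ℚ_[3])⁻¹ * (T + T0) + (3 : ℚ_[3])⁻¹ * (T ^ 2 + T * T0 + T0 ^ 2)‖ ≤ 1 := by
      refine (IsUltrametricDist.norm_add_le_max _ _).trans (max_le ?_ ?_)
      · refine (IsUltrametricDist.norm_add_le_max _ _).trans (max_le (by rw [norm_one]) ?_)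
        rw [norm_mul, norm_inv_two₃, one_mul]
        exact ((IsUltrametricDist.norm_add_le_max _ _).trans (max_le hTn hT0n)).trans (by norm_num)
      · rw [norm_mul, h3i]
        have : ‖T ^ 2 + T * T0 + T0 ^ 2‖ ≤ 1 / 9 := by
          refine (IsUltrametricDist.norm_add_le_max _ _).trans (max_le ?_ ?_)
          · refine (IsUltrametricDist.norm_add_le_max _ _).trans (max_le ?_ ?_)
            · rw [norm_pow]; calc ‖T‖ ^ 2 ≤ (1 / 3) ^ 2 := by gcongr
                _ = 1 / 9 := by norm_num
            · rw [norm_mul]; calc ‖T‖ * ‖T0‖ ≤ 1 / 3 * (1 / 3) := by gcongr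
                _ = 1 / 9 := by norm_num
          · rw [norm_pow]; calc ‖T0‖ ^ 2 ≤ (1 / 3) ^ 2 := by gcongr
              _ = 1 / 9 := by norm_num
        calc 3 * ‖T ^ 2 + T * T0 + T0 ^ 2‖ ≤ 3 * (1 / 9) := by gcongr
          _ ≤ 1 := by norm_num
    calc ‖T - T0‖ * _ ≤ 1 / 27 * 1 := by gcongr
      _ = 1 / 27 := mul_one _
  have hU : (((u ^ 2 - 1 : ℤ)) : ℚ_[3]) = -T0 := by rw [hT0]; push_cast; ring
  rw [hU]
  have hsplit : (2 : ℚ_[3])⁻¹ * padicLogSeries 3 (t ^ 2) - (2 : ℚ_[3])⁻¹ * (-T0 - (-T0) ^ 2 / 2 + (-T0) ^ 3 / 3) =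
      (2 : ℚ_[3])⁻¹ * ((padicLogSeries 3 (t ^ 2) + (T + T ^ 2 / 2 + T ^ 3 / 3)) -
        ((T + T ^ 2 / 2 + T ^ 3 / 3) - (T0 + T0 ^ 2 / 2 + T0 ^ 3 / 3))) := by ring
  rw [hsplit, norm_mul, norm_inv_two₃, one_mul]
  refine (norm_sub_le_max₃ _ _).trans (max_le (hL.trans ?_) hP)
  calc ‖T‖ ^ 4 ≤ (1 / 3) ^ 4 := by gcongr
    _ ≤ 1 / 27 := by norm_num

/-! ### §3 Assembly at second order: `h mod 27` -/

/-- `w ≡ ω`, `σ² ≡ 2κ` and `C²σ² ≡ 9u (mod 3⁵)` — the first-order links one digit further. [folklore] -/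
theorem norm_mul_tateSigmaSq_sub_le_o2 {q L C2 : ℚ_[3]} {ℓ γ ω κ u : ℤ} (hq : ‖q‖ ≤ 1 / 3) (hL : ‖L - ℓ‖ ≤ 1 / 81)
    (hℓ : ‖(ℓ : ℚ_[3])‖ ≤ 1 / 3) (hC : ‖C2 - γ‖ ≤ 1 / 27) (h3γ : ¬ (3 : ℤ) ∣ γ) (hω9 : (9 : ℤ) ∣ ω)
    (hω : (243 : ℤ) ∣ ℓ ^ 2 - ω * γ) (hκ9 : (9 : ℤ) ∣ κ) (hκ : (2187 : ℤ) ∣ 360 * ω + 30 * ω ^ 2 + ω ^ 3 - 720 * κ)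
    (hu : 9 * u = 2 * γ * κ) : ‖C2 * tateSigmaSq q (coshOfSq (L ^ 2 / C2)) - 9 * u‖ ≤ 1 / 243 := by
  have hγn : ‖(γ : ℚ_[3])‖ = 1 := norm_intCast_eq_one_of_not_dvd h3γ
  have hCn : ‖C2‖ = 1 := by
    rw [← hγn]; exact Padic.norm_eq_of_norm_sub_lt_right (hC.trans_lt (by rw [hγn]; norm_num))
  have hC0 : C2 ≠ 0 := by intro h; rw [h, norm_zero] at hCn; exact zero_ne_one hCn
  have hωn : ‖(ω : ℚ_[3])‖ ≤ 1 / 9 := (norm_intCast_le_of_pow_dvd (k := 2) (by norm_num; exact hω9)).trans (by norm_num)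
  have hκn : ‖(κ : ℚ_[3])‖ ≤ 1 / 9 := (norm_intCast_le_of_pow_dvd (k := 2) (by norm_num; exact hκ9)).trans (by norm_num)
  have hLn : ‖L‖ ≤ 1 / 3 := by
    rw [show L = (L - ℓ) + ℓ by ring]; exact (IsUltrametricDist.norm_add_le_max _ _).trans (max_le (hL.trans (by norm_num)) hℓ)
  have hw : ‖L ^ 2 / C2 - ω‖ ≤ 1 / 243 := by
    rw [div_sub' hC0, norm_div, hCn, div_one]
    have : L ^ 2 - C2 * ω = (L - ℓ) * (L + ℓ) + (((ℓ ^ 2 - ω * γ : ℤ) : ℚ_[3])) + -((ω : ℚ_[3]) * (C2 - γ)) := by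
      push_cast; ring
    rw [this]
    refine (IsUltrametricDist.norm_add_le_max _ _).trans (max_le ?_ ?_)
    · refine (IsUltrametricDist.norm_add_le_max _ _).trans (max_le ?_ ?_)
      · rw [norm_mul]
        calc ‖L - ℓ‖ * ‖L + ℓ‖ ≤ 1 / 81 * (1 / 3) := by
              gcongr; exact (IsUltrametricDist.norm_add_le_max _ _).trans (max_le hLn hℓ)
          _ = 1 / 243 := by norm_num
      · exact (norm_intCast_le_of_pow_dvd (k := 5) (by norm_num; exact hω)).trans (by norm_num)
    · rw [norm_neg, norm_mul]
      calc ‖(ω : ℚ_[3])‖ * ‖C2 - γ‖ ≤ 1 / 9 * (1 / 27) := by gcongr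
        _ = 1 / 243 := by norm_num
  have hc1 := norm_coshOfSq_sub_one_sub_intCast_le_o2 hw hω9 hκ
  set c := coshOfSq (L ^ 2 / C2) with hc
  have hc1n : ‖c - 1‖ ≤ 1 / 9 := by
    rw [show c - 1 = ((c - 1) - κ) + κ by ring]
    exact (IsUltrametricDist.norm_add_le_max _ _).trans (max_le (hc1.trans (by norm_num)) hκn)
  have hcn : ‖c‖ ≤ 1 := by
    rw [show c = (c - 1) + 1 by ring]
    exact (IsUltrametricDist.norm_add_le_max _ _).trans (max_le (hc1n.trans (by norm_num)) (by rw [norm_one]))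
  have hP := norm_tprod_tateSigmaSq_factor_sub_one_le (hq.trans_lt (by norm_num)) hcn
  set P := ∏' n : ℕ, (1 - 2 * q ^ (n + 1) * c + q ^ (2 * (n + 1))) ^ 2 / (1 - q ^ (n + 1)) ^ 4 with hPdef
  have hdef : tateSigmaSq q c = 2 * (c - 1) * P := by rw [tateSigmaSq]
  have h2 : ‖(2 : ℚ_[3])‖ ≤ 1 := by
    rw [show (2 : ℚ_[3]) = ((2 : ℤ) : ℚ_[3]) by norm_cast]; exact Padic.norm_int_le_one _
  have h9u : (9 : ℚ_[3]) * u = 2 * γ * κ := by exact_mod_cast hu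
  have hsplit : C2 * (2 * (c - 1) * P) - 9 * u =
      2 * C2 * (c - 1) * (P - 1) + 2 * C2 * ((c - 1) - κ) + 2 * κ * (C2 - γ) := by rw [h9u]; ring
  rw [hdef, hsplit]
  refine (IsUltrametricDist.norm_add_le_max _ _).trans (max_le ?_ ?_)
  · refine (IsUltrametricDist.norm_add_le_max _ _).trans (max_le ?_ ?_)
    · rw [norm_mul, norm_mul, norm_mul, hCn]
      calc ‖(2 : ℚ_[3])‖ * 1 * ‖c - 1‖ * ‖P - 1‖ ≤ 1 * 1 * (1 / 9) * (‖q‖ * ‖c - 1‖) := by gcongr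
        _ ≤ 1 * 1 * (1 / 9) * (1 / 3 * (1 / 9)) := by gcongr
        _ = 1 / 243 := by norm_num
    · rw [norm_mul, norm_mul, hCn]
      calc ‖(2 : ℚ_[3])‖ * 1 * ‖(c - 1) - κ‖ ≤ 1 * 1 * (1 / 243) := by gcongr
        _ = 1 / 243 := by norm_num
  · rw [norm_mul, norm_mul]
    calc ‖(2 : ℚ_[3])‖ * ‖(κ : ℚ_[3])‖ * ‖C2 - γ‖ ≤ 1 * (1 / 9) * (1 / 27) := by gcongr
      _ = 1 / 243 := by norm_num

/-- **The second-order REG3CERT kernel certificate (`v₃(e(Q)) = 1`).** `W/ℚ` globally minimal with `a₁, a₂, c₄, c₆`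
(read in `ℚ₃`) as given, `3 ∤ c₄`, `3 ∤ c₆`, and `(W.j)⁻¹ = Δ/c₄³` in `ℚ₃` with `3 ∣ Δ`; `(x, y) = (a/e², b/e³)`,
`e = 3e'`, `3 ∤ e'`, `3 ∤ b`, `gcd(a, e) = 1`; integers `γ, ζ, ℓ, ω, κ, u` with `27 ∣ c₄c₄³ + γc₆(c₄³ + 240Δ)`,
`3 ∤ γ`, `81 ∣ ae + ζb`, `3⁵ ∣ 6ζ + 3a₁ζ² + 2(a₁² + a₂)ζ³ − 6ℓ`, `9 ∣ ω`, `3⁵ ∣ ℓ² − ωγ`, `9 ∣ κ`,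
`3⁷ ∣ 360ω + 30ω² + ω³ − 720κ`, `9u = 2γκ`, `3 ∤ u`. If **`3⁴ ∤ 6E − 3E² + 2E³ − 6U + 3U² − 2U³`** (`E = e'⁴ − 1`,
`U = u² − 1`), then for EVERY `q` with `‖q‖ < 1` AND `j(q) = j(W)`, `heightFourOneCoord W 3 q x y ≠ 0` — `h ≡ ½[(E − E²/2 +
E³/3) − (U − U²/2 + U³/3)] (mod 27)`. Decides every REG3CERT row with `v₃(e(Q)) = 1`, `v₃(h(Q)) ≤ 2`.
[cite: SteinWuthrich2013, §4.2] [cite: Iwasawa1972PadicL, §4.4] [cite: SilvermanATAEC1994, Lemma V.5.1] -/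
theorem heightFourOneCoord_ne_zero_of_residueCertO2 (W : WeierstrassCurve ℚ) [W.IsElliptic] [W.IsGloballyMinimal]
    {a₁ a₂ c4 c6 D : ℤ} (ha1 : (W.baseChange ℚ_[3]).a₁ = a₁) (ha2 : (W.baseChange ℚ_[3]).a₂ = a₂)
    (hc4 : (W.baseChange ℚ_[3]).c₄ = c4) (hc6 : (W.baseChange ℚ_[3]).c₆ = c6) (h3c4 : ¬ (3 : ℤ) ∣ c4)
    (h3c6 : ¬ (3 : ℤ) ∣ c6) (hjinv : ((W.j : ℚ_[3]))⁻¹ = (D : ℚ_[3]) / (c4 : ℚ_[3]) ^ 3) (h3D : (3 : ℤ) ∣ D)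
    {a b : ℤ} {e' : ℕ} (h3e' : ¬ (3 : ℤ) ∣ e') (h3b : ¬ (3 : ℤ) ∣ b) (hcop : Nat.Coprime a.natAbs (3 * e'))
    {x y : ℚ} (hx : x = a / ((3 * e' : ℕ) : ℚ) ^ 2) (hy : y = b / ((3 * e' : ℕ) : ℚ) ^ 3)
    {γ ζ ℓ ω κ u : ℤ} (hγ : (27 : ℤ) ∣ c4 * c4 ^ 3 + γ * c6 * (c4 ^ 3 + 240 * D)) (h3γ : ¬ (3 : ℤ) ∣ γ)
    (hζ : (81 : ℤ) ∣ a * (3 * e' : ℕ) + ζ * b)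
    (hℓ : (243 : ℤ) ∣ 6 * ζ + 3 * a₁ * ζ ^ 2 + 2 * (a₁ ^ 2 + a₂) * ζ ^ 3 - 6 * ℓ)
    (hω9 : (9 : ℤ) ∣ ω) (hω : (243 : ℤ) ∣ ℓ ^ 2 - ω * γ) (hκ9 : (9 : ℤ) ∣ κ)
    (hκ : (2187 : ℤ) ∣ 360 * ω + 30 * ω ^ 2 + ω ^ 3 - 720 * κ) (hu : 9 * u = 2 * γ * κ) (h3u : ¬ (3 : ℤ) ∣ u)
    (hcert : ¬ (81 : ℤ) ∣ 6 * ((e' : ℤ) ^ 4 - 1) - 3 * ((e' : ℤ) ^ 4 - 1) ^ 2 + 2 * ((e' : ℤ) ^ 4 - 1) ^ 3 -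
      6 * (u ^ 2 - 1) + 3 * (u ^ 2 - 1) ^ 2 - 2 * (u ^ 2 - 1) ^ 3)
    {q : ℚ_[3]} (hq : ‖q‖ < 1) (hj : tateJ q = (W.j : ℚ_[3])) : heightFourOneCoord W 3 q x y ≠ 0 := by
  have hq3 : ‖q‖ ≤ 1 / 3 := norm_le_third_of_norm_lt_one hq
  have he0 : (3 * e' : ℕ) ≠ 0 := by have : e' ≠ 0 := (by rintro rfl; exact h3e' (by simp)); positivity
  have hb0 : b ≠ 0 := by rintro rfl; exact h3b (dvd_zero 3)
  have h3e : (3 : ℤ) ∣ ((3 * e' : ℕ) : ℤ) := ⟨e', by push_cast; ring⟩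
  have hqD : ‖q - (D : ℚ_[3]) / (c4 : ℚ_[3]) ^ 3‖ ≤ 1 / 9 := by
    have h := norm_inv_tateJ_sub_le hq
    rw [hj, hjinv, ← norm_neg, neg_sub] at h
    refine h.trans ?_
    calc ‖q‖ * ‖q‖ ≤ 1 / 3 * (1 / 3) := by gcongr
      _ = 1 / 9 := by norm_num
  have hC := norm_uniformisationScaleSq_sub_le_o2 W hc4 hc6 h3c4 h3c6 h3D hγ hqD
  obtain ⟨hzζ, hz⟩ := norm_z_sub_le (ζ := ζ) h3e h3b hζ
  obtain ⟨hL, hℓn⟩ := norm_padicFormalLog_sub_intCast_le W ha1 ha2 hℓ hzζ hz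
  have hwdef : logUnitParamSq W 3 q x y =
      (W.baseChange ℚ_[3]).padicFormalLog (-((a : ℚ_[3]) * ((3 * e' : ℕ) : ℚ_[3])) / (b : ℚ_[3])) ^ 2 /
        uniformisationScaleSq W 3 q := by
    rw [logUnitParamSq, hx, hy, neg_div_cast_eq hb0 he0]
  have hY := norm_mul_tateSigmaSq_sub_le_o2 hq3 hL hℓn hC h3γ hω9 hω hκ9 hκ hu
  rw [← hwdef] at hY
  have hlogY := norm_padicLog_sub_le_of_norm_sub_le_o2 h3u hY
  have hden : x.den = (3 * e') ^ 2 := by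
    have hpos : (0 : ℤ) < ((3 * e' : ℕ) : ℤ) ^ 2 := by positivity
    have hcop2 : Nat.Coprime a.natAbs ((((3 * e' : ℕ) : ℤ) ^ 2).natAbs) := by
      rw [Int.natAbs_pow, Int.natAbs_natCast]; exact hcop.pow_right 2
    have h := Rat.den_div_eq_of_coprime hpos hcop2
    have hx' : x = ((a : ℤ) : ℚ) / ((((3 * e' : ℕ) : ℤ) ^ 2 : ℤ) : ℚ) := by rw [hx]; push_cast; ring
    rw [← hx'] at h
    exact_mod_cast h
  have h3e2 : ¬ (3 : ℤ) ∣ ((e' : ℤ) ^ 2) := fun h => h3e' (Int.Prime.dvd_pow' (by norm_num) h)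
  have hYd : ‖(((x.den : ℚ)) : ℚ_[3]) - 9 * (((e' : ℤ) ^ 2 : ℤ) : ℚ_[3])‖ ≤ 1 / 243 := by
    rw [hden]; push_cast; ring_nf; rw [norm_zero]; norm_num
  have hlogd := norm_padicLog_sub_le_of_norm_sub_le_o2 h3e2 hYd
  intro h0
  rw [heightFourOneCoord] at h0
  have heq := sub_eq_zero.mp h0
  rw [heq] at hlogd
  set PU : ℚ_[3] := (((u ^ 2 - 1 : ℤ)) : ℚ_[3]) - (((u ^ 2 - 1 : ℤ)) : ℚ_[3]) ^ 2 / 2 +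
    (((u ^ 2 - 1 : ℤ)) : ℚ_[3]) ^ 3 / 3 with hPU
  set PE : ℚ_[3] := (((((e' : ℤ) ^ 2) ^ 2 - 1 : ℤ)) : ℚ_[3]) - (((((e' : ℤ) ^ 2) ^ 2 - 1 : ℤ)) : ℚ_[3]) ^ 2 / 2 +
    (((((e' : ℤ) ^ 2) ^ 2 - 1 : ℤ)) : ℚ_[3]) ^ 3 / 3 with hPE
  have hdiff : ‖(2 : ℚ_[3])⁻¹ * PE - (2 : ℚ_[3])⁻¹ * PU‖ ≤ 1 / 27 := by
    have : (2 : ℚ_[3])⁻¹ * PE - (2 : ℚ_[3])⁻¹ * PU =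
        (padicLog 3 (uniformisationScaleSq W 3 q * tateSigmaSq q (coshOfSq (logUnitParamSq W 3 q x y))) -
          (2 : ℚ_[3])⁻¹ * PU) -
        (padicLog 3 (uniformisationScaleSq W 3 q * tateSigmaSq q (coshOfSq (logUnitParamSq W 3 q x y))) -
          (2 : ℚ_[3])⁻¹ * PE) := by ring
    rw [this]; exact (norm_sub_le_max₃ _ _).trans (max_le hlogY hlogd)
  have hid : (2 : ℚ_[3])⁻¹ * PE - (2 : ℚ_[3])⁻¹ * PU = (12 : ℚ_[3])⁻¹ *
      (((6 * ((e' : ℤ) ^ 4 - 1) - 3 * ((e' : ℤ) ^ 4 - 1) ^ 2 + 2 * ((e' : ℤ) ^ 4 - 1) ^ 3 -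
        6 * (u ^ 2 - 1) + 3 * (u ^ 2 - 1) ^ 2 - 2 * (u ^ 2 - 1) ^ 3 : ℤ)) : ℚ_[3]) := by
    have h2 : (2 : ℚ_[3]) ≠ 0 := by norm_num
    have h3 : (3 : ℚ_[3]) ≠ 0 := by norm_num
    have h12 : (12 : ℚ_[3]) ≠ 0 := by norm_num
    rw [hPE, hPU]; push_cast; field_simp; ring
  have h12n : ‖(12 : ℚ_[3])⁻¹‖ = 3 := by
    rw [show (12 : ℚ_[3]) = ((12 : ℕ) : ℚ_[3]) by norm_cast]
    have := norm_inv_natCast_eq (m := 12) (u := 4) (k := 1) (by norm_num) (by norm_num)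
    rw [this, pow_one]
  rw [hid, norm_mul, h12n] at hdiff
  have h81 : ((3 : ℕ) : ℤ) ^ 4 ∣ 6 * ((e' : ℤ) ^ 4 - 1) - 3 * ((e' : ℤ) ^ 4 - 1) ^ 2 + 2 * ((e' : ℤ) ^ 4 - 1) ^ 3 -
      6 * (u ^ 2 - 1) + 3 * (u ^ 2 - 1) ^ 2 - 2 * (u ^ 2 - 1) ^ 3 :=
    (Padic.norm_int_le_pow_iff_dvd (p := 3) _ 4).mp (by
      have : ‖((((6 * ((e' : ℤ) ^ 4 - 1) - 3 * ((e' : ℤ) ^ 4 - 1) ^ 2 + 2 * ((e' : ℤ) ^ 4 - 1) ^ 3 -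
          6 * (u ^ 2 - 1) + 3 * (u ^ 2 - 1) ^ 2 - 2 * (u ^ 2 - 1) ^ 3 : ℤ)) : ℚ_[3]))‖ ≤ 1 / 81 := by linarith
      exact this.trans (by norm_num))
  exact hcert (by simpa using h81)

end Summit.BirchSwinnertonDyer.Rank1Residual.X11b.RegMult.KernelCert
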